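import Mathlib
import Literature.NumberTheory.Sieve.ParityBatemanHorn

/-!
# Sketch — crux-ideate stmt-Parity-9769 (NormalFamilyBound), round 1, ideator 3

First lemmas / transfer statements of the two idea cards
`friable-euler-anchor` and `half-weight-unimodular-pairs`.
Nothing here is proved; every `def … : Prop` must elaborate.
-/

namespace Summit.Parity.BatemanHorn.Cruxes.NormalFamilyBound.Ideator3

open scoped BigOperators
open Filter

noncomputable section

/-- `ρ_F(d)` = number of residues `n mod d` with `d ∣ F(n)`, `F = ∏ f_i`. -/
def rootCount {k : ℕ} (f : Fin k → Polynomial ℤ) (d : ℕ) : ℕ :=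
  ((Finset.range d).filter (fun n : ℕ => (d : ℤ) ∣ ∏ i, (f i).eval (n : ℤ))).card

/-- `Ω_f(n) = Σ_i Ω(f_i(n))` exactly as in the crux. -/
def OmegaF {k : ℕ} (f : Fin k → Polynomial ℤ) (n : ℕ) : ℕ :=
  ∑ i, ArithmeticFunction.cardFactors (((f i).eval (n : ℤ)).toNat)

/-- The crux family `H_x(z)`. -/
def H {k : ℕ} (f : Fin k → Polynomial ℤ) (x : ℕ) (z : ℂ) : ℂ :=
  (x : ℂ)⁻¹ * Complex.exp ((k : ℂ) * (1 - z) * (Real.log (Real.log x) : ℂ)) *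
    ∑ n ∈ Finset.range (x + 1), z ^ OmegaF f n

/-- `w`-friable (all prime factors `≤ w`). -/
def Friable (w m : ℕ) : Prop := ∀ p ∈ m.primeFactors, p ≤ w

instance (w m : ℕ) : Decidable (Friable w m) := by unfold Friable; infer_instance

/-- Local density that the `w`-friable part of `F(n)` is exactly `m` (for `m` `w`-friable):
`δ_w(m) = ∏_{p ≤ w, p ∤ m} (1 − ρ(p)/p) · ∏_{p^a ∥ m} (ρ(p^a)/p^a − ρ(p^{a+1})/p^{a+1})`. -/
def friableDensity {k : ℕ} (f : Fin k → Polynomial ℤ) (w m : ℕ) : ℝ :=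
  (∏ p ∈ (Nat.primesBelow (w + 1)).filter (fun p => ¬ p ∣ m), (1 - (rootCount f p : ℝ) / p)) *
  ∏ p ∈ m.primeFactors,
    ((rootCount f (p ^ m.factorization p) : ℝ) / (p : ℝ) ^ m.factorization p -
      (rootCount f (p ^ (m.factorization p + 1)) : ℝ) / (p : ℝ) ^ (m.factorization p + 1))

/-- CARD friable-euler-anchor · First lemma (FriableLocalLaw).
Friable Landau–Selberg–Delange law for the root-count densities, complex exponent,
sharp cutoff `m ≤ w^u` (the limit `L = L_f(z,u)` is `G_f(z)` times a `z`-Dickman factor `j_{k,z}(u)`):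
`(log w)^{-k(z-1)} Σ_{m ≤ w^u, m w-friable} z^{Ω(m)} δ_w(m) → L` as `w → ∞`, for every `|z| < 2`, `u > 0`.
Provable with current technology (saddle point on `∏_{p≤w}(1 + (z-1)ρ(p)/p^{1+s} + …)`,
de la Bretèche–Tenenbaum / Tenenbaum–Wu friable mean values); an Euler product EXISTS in the friable variable. -/
def FriableLocalLaw : Prop :=
  ∀ (k : ℕ) (f : Fin k → Polynomial ℤ), Literature.NumberTheory.Sieve.IsBatemanHornSystem f →
    ∀ u : ℝ, 0 < u → ∀ z : ℂ, ‖z‖ < 2 → ∃ L : ℂ,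
      Tendsto (fun w : ℕ =>
        Complex.exp (-(k : ℂ) * (z - 1) * (Real.log (Real.log w) : ℂ)) *
          ∑ m ∈ (Finset.Icc 1 ⌊(w : ℝ) ^ u⌋₊).filter (fun m => Friable w m),
            z ^ ArithmeticFunction.cardFactors m * (friableDensity f w m : ℂ))
        atTop (nhds L)

/-- The rough-cofactor transform `N_{x,w}(z; m) = Σ_{n ≤ x : (F(n))_{≤ w} = m} z^{Ω_f(n) − Ω(m)}`
(friable part of `F(n) = ∏ f_i(n)` equal to `m`; the weight is `z` to the number of prime factors `> w`). -/
def roughTransform {k : ℕ} (f : Fin k → Polynomial ℤ) (x w m : ℕ) (z : ℂ) : ℂ :=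
  ∑ n ∈ (Finset.range (x + 1)).filter (fun n : ℕ =>
      (∏ p ∈ (Nat.primesBelow (w + 1)),
          p ^ ((∏ i, ((f i).eval (n : ℤ)).toNat).factorization p)) = m),
    z ^ (OmegaF f n - ArithmeticFunction.cardFactors m)

/-- CARD friable-euler-anchor · class form of flatness (RoughCofactorFlatness).
At friability `w = exp((log x)^{1-a})` the rough transform depends on the friable class `m ≤ √x` ONLY through the
explicit density `δ_w(m)` and through the SIZE `u_m = log m / log x` of the class (the cofactor has size `x^g/m`, so its
prime-factor count has mean `k·log((g·log x − log m)/log w)` — kit j009177 sees exactly this size law and nothing else):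
`N_{x,w}(z; m) = δ_w(m)·x·Φ_x(u_m) + O(δ_w(m)·x·(log x)^{a k (Re z − 1) − c})`, with `Φ_x : ℝ → ℂ` Lipschitz of
trivial size, a saving `c > 0`, and for `Re z ≤ 0` additionally `|Φ_x(u)| ≤ C (log x)^{a k (Re z − 1)}` (tilted Liouville
cancellation among `w`-ROUGH values only). The harmonic/divisor form actually used in the Transfer is `HarmonicFlatness`
below (there the size law sits inside `Ψ̂_x(0)` and no `m`-dependence arises). -/
def RoughCofactorFlatness : Prop :=
  ∀ (k : ℕ) (f : Fin k → Polynomial ℤ), Literature.NumberTheory.Sieve.IsBatemanHornSystem f →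
    ∃ η : ℝ, 0 < η ∧ η ≤ 1 / 4 ∧ ∃ a : ℝ, 0 < a ∧ a < 1 ∧
    ∀ z ∈ {z : ℂ | -η < z.re ∧ z.re < 7 / 4 ∧ |z.im| < η}, ∃ c : ℝ, 0 < c ∧
      ∃ C : ℝ, ∃ x₀ : ℕ, ∀ x : ℕ, x₀ ≤ x → ∃ Φ : ℝ → ℂ,
        (∀ u u' : ℝ, ‖Φ u - Φ u'‖ ≤ C * |u - u'| * Real.log x ^ (a * k * (‖z‖ - 1))) ∧
        (∀ u : ℝ, ‖Φ u‖ ≤ C * Real.log x ^ (a * k * (‖z‖ - 1))) ∧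
        (z.re ≤ 0 → ∀ u : ℝ, ‖Φ u‖ ≤ C * Real.log x ^ (a * k * (z.re - 1))) ∧
        ∀ m : ℕ, 1 ≤ m → (m : ℝ) ≤ Real.sqrt x →
          Friable ⌊Real.exp (Real.log x ^ (1 - a))⌋₊ m →
          ‖roughTransform f x ⌊Real.exp (Real.log x ^ (1 - a))⌋₊ m z
              - (friableDensity f ⌊Real.exp (Real.log x ^ (1 - a))⌋₊ m : ℂ) * x *
                  Φ (Real.log m / Real.log x)‖
            ≤ C * friableDensity f ⌊Real.exp (Real.log x ^ (1 - a))⌋₊ m * x *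
                Real.log x ^ (a * k * (z.re - 1) - c)

/-- CARD friable-euler-anchor · residual (RoughCountBound): the crux statement for the ROUGH count only —
`Σ_{n ≤ x} z^{Ω_{>w}(F(n))} ≪ x · T^{k(Re z − 1)}`, `T = log x / log w = (log x)^a` — i.e. NormalFamilyBound at
strength `a` (needed saving `T^{k(|z| − Re z)} = (log x)^{a k (|z| − Re z)}` instead of `(log x)^{k(|z| − Re z)}`).
Same KIND as the crux (honest), smaller exponent; `m = 1` in `roughTransform` would be the friable-free class,
here we take the all-`n` rough count. -/
def RoughCountBound : Prop :=
  ∀ (k : ℕ) (f : Fin k → Polynomial ℤ), Literature.NumberTheory.Sieve.IsBatemanHornSystem f →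
    ∃ η : ℝ, 0 < η ∧ η ≤ 1 / 4 ∧ ∃ a : ℝ, 0 < a ∧ a < 1 ∧
    ∀ z ∈ {z : ℂ | -η < z.re ∧ z.re < 7 / 4 ∧ |z.im| < η}, ∃ C : ℝ, ∃ x₀ : ℕ, ∀ x : ℕ, x₀ ≤ x →
      ‖∑ n ∈ Finset.range (x + 1),
          z ^ (OmegaF f n - ArithmeticFunction.cardFactors
                (∏ p ∈ Nat.primesBelow (⌊Real.exp (Real.log x ^ (1 - a))⌋₊ + 1),
                    p ^ ((∏ i, ((f i).eval (n : ℤ)).toNat).factorization p)))‖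
        ≤ C * x * (Real.log x ^ a) ^ ((k : ℝ) * (z.re - 1))

/-- CARD friable-euler-anchor · HarmonicFlatness (the genuinely new residual, harmonic form of flatness):
the rough-count weight `Ψ(n) = z^{Ω_{>w}(F(n))}` has small correlation with every non-principal FRIABLE root
harmonic: `Σ_{1 < q ≤ √x, q w-friable} (h_z(q)/q) Σ_{a coprime to q} ρ̂_q(a) Ψ̂_x(a/q) ≪ x T^{k(Re z −1)}`,
`ρ̂_q(a) = Σ_{ν root mod q} e(−aν/q)`, `Ψ̂_x(a/q) = Σ_{n ≤ x} Ψ(n) e(an/q)`, `h_z(q) = (z−1)^{ω(q)} z^{Ω(q)−ω(q)}`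
(the friable Euler factor `(log w)^{k(z−1)} G_q(z)` has ALREADY been divided out of each harmonic — that is
the point of the lever; the local correction `G_q` is suppressed in this first transcription). -/
def HarmonicFlatness : Prop :=
  ∀ (k : ℕ) (f : Fin k → Polynomial ℤ), Literature.NumberTheory.Sieve.IsBatemanHornSystem f →
    ∃ η : ℝ, 0 < η ∧ η ≤ 1 / 4 ∧ ∃ a : ℝ, 0 < a ∧ a < 1 ∧
    ∀ z ∈ {z : ℂ | -η < z.re ∧ z.re < 7 / 4 ∧ |z.im| < η}, ∃ C : ℝ, ∃ x₀ : ℕ, ∀ x : ℕ, x₀ ≤ x →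
      ‖∑ q ∈ (Finset.Icc 2 (Nat.sqrt x)).filter (fun q => Friable ⌊Real.exp (Real.log x ^ (1 - a))⌋₊ q),
          ((z - 1) ^ ArithmeticFunction.cardDistinctFactors q *
              z ^ (ArithmeticFunction.cardFactors q - ArithmeticFunction.cardDistinctFactors q) / (q : ℂ)) *
          ∑ b ∈ (Finset.range q).filter (fun b => Nat.Coprime b q),
            (∑ ν ∈ (Finset.range q).filter (fun ν : ℕ => (q : ℤ) ∣ ∏ i, (f i).eval (ν : ℤ)),
                Complex.exp (-2 * Real.pi * Complex.I * (b * ν : ℂ) / (q : ℂ))) *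
            ∑ n ∈ Finset.range (x + 1),
              z ^ (OmegaF f n - ArithmeticFunction.cardFactors
                (∏ p ∈ Nat.primesBelow (⌊Real.exp (Real.log x ^ (1 - a))⌋₊ + 1),
                    p ^ ((∏ i, ((f i).eval (n : ℤ)).toNat).factorization p))) *
              Complex.exp (2 * Real.pi * Complex.I * (b * n : ℂ) / (q : ℂ))‖
        ≤ C * x * (Real.log x ^ a) ^ ((k : ℝ) * (z.re - 1))

/-! ### Card half-weight-unimodular-pairs -/

/-- Convolution square root of `z^Ω`: `g_z(p^a) = z^a · binom(2a,a)/4^a`, i.e. the coefficients of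
`(1 − zT)^{-1/2}`; `|g_z(p)| = |z|/2`. -/
def halfWeight (z : ℂ) (m : ℕ) : ℂ :=
  ∏ p ∈ m.primeFactors,
    z ^ m.factorization p * ((Nat.centralBinom (m.factorization p) : ℂ) / 4 ^ m.factorization p)

/-- CARD half-weight-unimodular-pairs · First lemma (a): `g_z ∗ g_z = z^Ω` (Dirichlet convolution),
from `Σ_b binom(2b,b) binom(2(a−b),a−b) = 4^a`. Elementary; provable now. -/
def HalfWeightSquare : Prop :=
  ∀ z : ℂ, ∀ m : ℕ, 1 ≤ m →
    ∑ d ∈ m.divisors, halfWeight z d * halfWeight z (m / d) = z ^ ArithmeticFunction.cardFactors m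

/-- CARD half-weight-unimodular-pairs · First lemma (b): unimodular-pair form of the crux sum for
`f = X²+1` (Lagrange: `(a²+b²)(c²+d²) = (ac+bd)² + (ad−bc)²`; the map is 4-to-1 onto
`{(m, m', n) : m·m' = n²+1}` because `n+i` is primitive in `ℤ[i]`):
`Σ_{ad−bc=1, |ac+bd| ≤ x} g_z(a²+b²) g_z(c²+d²) = 4 Σ_{|n| ≤ x} z^{Ω(n²+1)}`. Elementary; provable now. -/
def UnimodularPairIdentity : Prop :=
  ∀ z : ℂ, ∀ x : ℕ,
    (∑ a ∈ Finset.Icc (-(x + 1 : ℤ)) (x + 1), ∑ b ∈ Finset.Icc (-(x + 1 : ℤ)) (x + 1),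
      ∑ c ∈ Finset.Icc (-(x + 1 : ℤ)) (x + 1), ∑ d ∈ Finset.Icc (-(x + 1 : ℤ)) (x + 1),
        if a * d - b * c = 1 ∧ |a * c + b * d| ≤ (x : ℤ) then
          halfWeight z (a ^ 2 + b ^ 2).toNat * halfWeight z (c ^ 2 + d ^ 2).toNat else 0)
      = 4 * ∑ n ∈ Finset.Icc (-(x : ℤ)) x, z ^ ArithmeticFunction.cardFactors (n ^ 2 + 1).toNat

/-- CARD half-weight-unimodular-pairs · column law (Leans on; Hecke/LSD over `ℤ[i]`, known technology):
each column ALONE has Landau–Selberg–Delange cancellation with exponent `z/2`: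
`Σ_{a²+b² ≤ X} g_z(a²+b²) ~ c(z) · X (log X)^{z/2 − 1}`, locally uniformly in `|z| < 2`
(Dirichlet series `Σ g_z(m) r₂(m) m^{-s} ≈ ζ_{ℚ(i)}(s)^{z/2} G(s,z)`). -/
def GaussianColumnLaw : Prop :=
  ∀ z : ℂ, ‖z‖ < 2 → ∃ c : ℂ,
    Tendsto (fun X : ℕ =>
      (X : ℂ)⁻¹ * Complex.exp ((1 - z / 2) * (Real.log (Real.log X) : ℂ)) *
        ∑ a ∈ Finset.Icc (-(X : ℤ)) X, ∑ b ∈ Finset.Icc (-(X : ℤ)) X,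
          if a ^ 2 + b ^ 2 ≤ (X : ℤ) then halfWeight z (a ^ 2 + b ^ 2).toNat else 0)
      atTop (nhds c)

/-- CARD half-weight-unimodular-pairs · Transfer target C⁺ (UnimodularDecorrelation, `f = X²+1`):
in the bi-large regime `min(a²+b², c²+d²) ≥ exp((log x)^β)` the two half-weight columns decorrelate
across `ad − bc = 1` to the product of their column laws, with the Poisson-exact exponent:
the bi-large part of the unimodular sum is `≪ x (log x)^{Re z − 1}`; the complementary corners are
PROVABLY negligible when `β < 2 cos(arg z) − 1` (Nair–Tenenbaum on the long column). -/
def UnimodularDecorrelation : Prop :=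
  ∃ η : ℝ, 0 < η ∧ η ≤ 1 / 4 ∧ ∀ z ∈ {z : ℂ | -η < z.re ∧ z.re < 7 / 4 ∧ |z.im| < η},
    ∃ β : ℝ, 0 < β ∧ β < 1 ∧ ∃ C : ℝ, ∃ x₀ : ℕ, ∀ x : ℕ, x₀ ≤ x →
      ‖∑ a ∈ Finset.Icc (-(x + 1 : ℤ)) (x + 1), ∑ b ∈ Finset.Icc (-(x + 1 : ℤ)) (x + 1),
        ∑ c ∈ Finset.Icc (-(x + 1 : ℤ)) (x + 1), ∑ d ∈ Finset.Icc (-(x + 1 : ℤ)) (x + 1),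
          if a * d - b * c = 1 ∧ |a * c + b * d| ≤ (x : ℤ) ∧
              Real.exp (Real.log x ^ β) ≤ ((a ^ 2 + b ^ 2 : ℤ) : ℝ) ∧
              Real.exp (Real.log x ^ β) ≤ ((c ^ 2 + d ^ 2 : ℤ) : ℝ) then
            halfWeight z (a ^ 2 + b ^ 2).toNat * halfWeight z (c ^ 2 + d ^ 2).toNat else 0‖
        ≤ C * x * Real.log x ^ (z.re - 1)

end

end Summit.Parity.BatemanHorn.Cruxes.NormalFamilyBound.Ideator3
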